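import Literature.MathematicalPhysics.QuantumLattice.HubbardNNNHoppingFluxThermal
import Literature.MathematicalPhysics.QuantumLattice.RayleighBottom
import Literature.MathematicalPhysics.QuantumLattice.SpinTwistedHubbardTorus
import HarnessLib

/-!
# The second-order (Kohn) ceiling on the flux stiffness of the `t–t'` Hubbard torus

Topic `Literature/MathematicalPhysics/QuantumLattice` (family `hubbard`); companion of
`HubbardNNNHoppingFluxStiffness.lean` (the f-sum ceiling `ρ_s L² ≤ K(ψ)`,
`stiffnessTT'_mul_sq_le_kinetic_of_isGroundStateInSector`) and `HubbardNNNHoppingFluxThermal.lean`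
(the `e₁`-kinetic operator `kinOpTT'`). Everything here is PROVED; no named facts.

* **The `e₁`-current operator** `curOpTT' L t' = Σ_{x,σ} (−i c†_{x+e₁,σ} c_{x,σ} + i c†_{x,σ} c_{x+e₁,σ})
  + t' Σ_{s,x,σ} (−i c†_{x+j_s,σ} c_{x,σ} + h.c.)` — the paramagnetic current coupling to a uniform
  vector potential along `e₁` (Scalapino–White–Zhang 1993 §II, `j_x^p`; Kohn 1964): the
  uniformly twisted torus satisfies, as quadratic forms,
  `Re⟨φ, H_u(θ) φ⟩ = Re⟨φ, H φ⟩ + (1 − cos(θ/L)) Re⟨φ, 𝒦 φ⟩ + sin(θ/L) Re⟨φ, 𝒥 φ⟩`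
  (`re_star_dotProduct_uniformTwistTT'_mulVec_eq_kin_cur`).
* **Second-order Rayleigh (Kohn) inequality** (`stiffnessTT'_mul_sq_le_of_isGroundStateInSector`):
  if `E^{tt'}_L(θ) − E^{tt'}_L(0) ≥ ρ θ²` for `|θ| ≤ θ₀`, then for every zero-flux sector ground state
  `ψ`, every vector `η` of the same sector and every real `λ`,
  `ρ L² ≤ ½ Re⟨ψ, 𝒦 ψ⟩ + 2λ Re⟨ψ, 𝒥 η⟩ + λ² Re⟨η, (H − E₀) η⟩`
  — the trial vectors `ψ ± λ(θ/L) η` in the variational principle at `±θ`; optimising `λ, η` gives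
  Kohn's formula `D ∝ ⟨−T_x⟩ − 2 Σ_n |⟨n|J|0⟩|²/(E_n − E₀)` as a one-sided inequality.
* **Certified-row form** (`stiffnessTT'_mul_sq_le_of_certified_moments`): with `η = 𝒥ψ` and the
  sum-rule (Cauchy–Schwarz) choice `λ = −M0_lo/M1_hi`: certified bounds `½Re⟨ψ,𝒦ψ⟩ ≤ K_hi`,
  `‖𝒥ψ‖² ≥ M0_lo ≥ 0`, `Re⟨𝒥ψ,(H−E₀)𝒥ψ⟩ ≤ M1_hi` (`M1_hi > 0`) give `ρ L² ≤ K_hi − M0_lo²/M1_hi`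
  (Bohigas–Lane–Martorell 1979; Lipparini 2008 eqs. (8.30), (10.64): `m₁ = ½⟨[F,[H,F]]⟩`, `m₋₁ ≥ m₀²/m₁`).

PRIOR FORMALISATION (same results, Summits side, programme pub-hubbard `bounds.tex` Thm 5 / Thm 5♯,
2026-08-20): `Summits/HubbardSuperconductivity/HubbardLadder/Bounds/CurrentOperatorTTPrime.lean`
(`Summit.HubbardSuperconductivity.HubbardLadder.Bounds.curOpTT'`), `StiffnessCeilingCurrentMoments.lean`
(`CurrentMomentStiffnessCeilingTT'`, `OptimalCurrentMomentCeilingTT'` = the certified-row form) and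
`StiffnessCeilingTrialDirection.lean` (`TrialDirectionStiffnessCeilingTT'` = the general-`η` form). This
file is the Literature-layer twin (no Summits import), written independently by the hubbard-obs cell.

References: W. Kohn, Phys. Rev. 133 (1964) A171 [Kohn1964]; D. J. Scalapino, S. R. White,
S. C. Zhang, PRB 47 (1993) 7995, §II [ScalapinoWhiteZhang1993]; O. Bohigas, A. M. Lane,
J. Martorell, Phys. Rep. 51 (1979) 267 [BohigasLaneMartorell1979]; E. Lipparini, Modern
Many-Particle Physics (2008), eqs. (8.30)–(8.33) [Lipparini2008]; H. Watanabe, J. Stat. Phys. 177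
(2019) 717, §2.2 [Watanabe2019].
-/

noncomputable section

namespace Literature.MathematicalPhysics.QuantumLattice

open Matrix Finset Literature.MathematicalPhysics.QuantumFieldTheory
  Literature.Probability.LatticeModels

open scoped ComplexConjugate ComplexOrder

variable {L : ℕ} [NeZero L]

/-! ### The `e₁`-current operator -/

section Defs

variable (L)

/-- The **`e₁`-current operator** of the `t–t'` torus (paramagnetic current along `e₁`, every bond
weighted by its `x₁`-advance times its hopping amplitude):
`Σ_{x,σ} (−i c†_{x+e₁,σ} c_{x,σ} + i c†_{x,σ} c_{x+e₁,σ}) + t' Σ_{s,x,σ} (−i c†_{x+j_s,σ} c_{x,σ} + i c†_{x,σ} c_{x+j_s,σ})`.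
[cite: ScalapinoWhiteZhang1993, §II] -/
def curOpTT' (t' : ℝ) :
    Matrix (Finset (Orb (FermionTorus 2 L))) (Finset (Orb (FermionTorus 2 L))) ℂ :=
  (∑ x : Site 2 L, ∑ σ : Fin 2,
      ((-Complex.I) • (creation (orb (FermionTorus.ofTorusSite (Site.shift x 0)) σ) *
          annihilation (orb (FermionTorus.ofTorusSite x) σ)) +
        Complex.I • (creation (orb (FermionTorus.ofTorusSite x) σ) *
          annihilation (orb (FermionTorus.ofTorusSite (Site.shift x 0)) σ)))) +
    (t' : ℂ) • diagPeierlsHopping L (fun _ _ => -Complex.I)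

end Defs

/-- `curOpTT'` is Hermitian (each summand is `−iX + iXᴴ`). [cite: ScalapinoWhiteZhang1993, §II] -/
theorem isHermitian_curOpTT' (t' : ℝ) : (curOpTT' L t').IsHermitian := by
  refine IsHermitian.add ?_ (isHermitian_ofReal_smul (isHermitian_diagPeierlsHopping L _) _)
  unfold Matrix.IsHermitian
  simp only [conjTranspose_sum]
  refine Finset.sum_congr rfl fun x _ => Finset.sum_congr rfl fun σ _ => ?_
  rw [conjTranspose_add, conjTranspose_smul, conjTranspose_smul,
    conjTranspose_creation_mul_annihilation, conjTranspose_creation_mul_annihilation, add_comm]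
  congr 2 <;> simp

/-- `Re⟨φ, curOpTT' φ⟩ = 2 (J_x(φ) + t' J_d(φ))` with `J_x(φ) = Σ_{x,σ} Im⟨φ, c†_{x+e₁,σ} c_{x,σ} φ⟩`,
`J_d(φ) = Σ_{s,x,σ} Im⟨φ, c†_{x+j_s,σ} c_{x,σ} φ⟩` — the bond currents multiplying `2 sin(θ/L)` in
`fluxEnergyTT'_le_rayleigh_uniformTwist`. [cite: Watanabe2019, §2.2.1] -/
theorem re_star_dotProduct_curOpTT'_mulVec (t' : ℝ) (φ : Fock (Orb (FermionTorus 2 L))) :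
    (star φ ⬝ᵥ (curOpTT' L t' *ᵥ φ)).re =
      2 * ((∑ x : Site 2 L, ∑ σ : Fin 2,
          (star φ ⬝ᵥ ((creation (orb (FermionTorus.ofTorusSite (Site.shift x 0)) σ) *
            annihilation (orb (FermionTorus.ofTorusSite x) σ)) *ᵥ φ)).im) +
        t' * ∑ s : Fin 2, ∑ x : Site 2 L, ∑ σ : Fin 2,
          (star φ ⬝ᵥ ((creation (orb (FermionTorus.ofTorusSite (x + torusDiagJump L s)) σ) *
            annihilation (orb (FermionTorus.ofTorusSite x) σ)) *ᵥ φ)).im) := by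
  have hx : (star φ ⬝ᵥ ((∑ x : Site 2 L, ∑ σ : Fin 2,
      ((-Complex.I) • (creation (orb (FermionTorus.ofTorusSite (Site.shift x 0)) σ) *
          annihilation (orb (FermionTorus.ofTorusSite x) σ)) +
        Complex.I • (creation (orb (FermionTorus.ofTorusSite x) σ) *
          annihilation (orb (FermionTorus.ofTorusSite (Site.shift x 0)) σ)))) *ᵥ φ)).re =
      2 * ∑ x : Site 2 L, ∑ σ : Fin 2,
          (star φ ⬝ᵥ ((creation (orb (FermionTorus.ofTorusSite (Site.shift x 0)) σ) *
            annihilation (orb (FermionTorus.ofTorusSite x) σ)) *ᵥ φ)).im := by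
    simp only [Matrix.sum_mulVec, dotProduct_sum, Complex.re_sum, add_mulVec, dotProduct_add,
      Complex.add_re, Finset.mul_sum, smul_mulVec, dotProduct_smul, smul_eq_mul]
    refine Finset.sum_congr rfl fun x _ => Finset.sum_congr rfl fun σ _ => ?_
    rw [star_dotProduct_creation_mul_annihilation_mulVec_swap
        (orb (FermionTorus.ofTorusSite (Site.shift x 0)) σ) (orb (FermionTorus.ofTorusSite x) σ)]
    simp only [Complex.mul_re, Complex.neg_re, Complex.neg_im, Complex.I_re, Complex.I_im,
      Complex.conj_re, Complex.conj_im]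
    ring
  unfold curOpTT'
  rw [add_mulVec, dotProduct_add, Complex.add_re, hx, smul_mulVec, dotProduct_smul, smul_eq_mul,
    Complex.re_ofReal_mul, re_star_dotProduct_diagPeierlsHopping_const_mulVec, Complex.neg_re,
    Complex.neg_im, Complex.I_re, Complex.I_im]
  ring

/-- **The uniform twist as kinetic and current operators**: for every vector `φ` (`L ≥ 3`),
`Re⟨φ, H_u(θ) φ⟩ = Re⟨φ, H^{tt'} φ⟩ + (1 − cos(θ/L)) Re⟨φ, kinOpTT' φ⟩ + sin(θ/L) Re⟨φ, curOpTT' φ⟩`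
(the Peierls factor `e^{iu} = 1 − (1 − cos u) + i sin u` bond by bond). [cite: Watanabe2019, §2.2.3 and §4.1] -/
theorem re_star_dotProduct_uniformTwistTT'_mulVec_eq_kin_cur (hL : 3 ≤ L) (t' U θ : ℝ)
    (φ : Fock (Orb (FermionTorus 2 L))) :
    (star φ ⬝ᵥ (uniformTwistTT' L t' U θ *ᵥ φ)).re =
      (star φ ⬝ᵥ (hubbardTorusTT' L 1 t' U *ᵥ φ)).re +
        (1 - Real.cos (θ / L)) * (star φ ⬝ᵥ (kinOpTT' L t' *ᵥ φ)).re +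
        Real.sin (θ / L) * (star φ ⬝ᵥ (curOpTT' L t' *ᵥ φ)).re := by
  rw [re_star_dotProduct_uniformTwistTT'_mulVec hL, re_star_dotProduct_kinOpTT'_mulVec,
    re_star_dotProduct_curOpTT'_mulVec]
  ring

/-! ### Sector bookkeeping -/

/-- `curOpTT'` conserves `N↑` and `N↓` (a sum of spin-diagonal hoppings). [cite: LiebPRL1989, Remark (2)] -/
theorem preservesSectors_curOpTT' (t' : ℝ) : PreservesSectors (curOpTT' L t') := by
  unfold curOpTT' diagPeierlsHopping
  refine PreservesSectors.add
    (PreservesSectors.sum fun x _ => PreservesSectors.sum fun σ _ => ?_)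
    (PreservesSectors.smul (PreservesSectors.sum fun s _ => PreservesSectors.sum fun x _ =>
      PreservesSectors.sum fun σ _ => ?_) _)
  · exact ((LiebThm1.preservesSectors_hopping _ _ σ).smul _).add
      ((LiebThm1.preservesSectors_hopping _ _ σ).smul _)
  · exact ((LiebThm1.preservesSectors_hopping _ _ σ).smul _).add
      ((LiebThm1.preservesSectors_hopping _ _ σ).smul _)

/-- `curOpTT'` maps every joint sector `(N, S^z = M)` into itself. [cite: LiebPRL1989, Remark (2)] -/
theorem curOpTT'_mulVec_mem_szSector (t' : ℝ) {N : ℕ} {M : ℝ}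
    {ψ : Fock (Orb (FermionTorus 2 L))} (hψ : ψ ∈ szSector N M) :
    curOpTT' L t' *ᵥ ψ ∈ szSector N M := by
  have hP := preservesSectors_curOpTT' (L := L) t'
  rw [mem_szSector_iff] at hψ ⊢
  refine ⟨hP.isNParticle_mulVec hψ.1, ?_⟩
  have hc : Commute (curOpTT' L t') HubbardWave0.spinZ := by
    rw [LiebThm1.spinZ_eq_diagonal]
    exact hP.commute_diagonal fun a b => (1 / 2 : ℂ) * ((a : ℂ) - (b : ℂ))
  rw [Matrix.mulVec_mulVec, ← hc.eq, ← Matrix.mulVec_mulVec, hψ.2, Matrix.mulVec_smul]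

/-! ### Quadratic-form bookkeeping -/

section Generic

variable {n : Type*} [Fintype n] [DecidableEq n]

/-- The sector energy prices every vector of the sector: `minEnergyOn H K · ‖φ‖² ≤ Re⟨φ, H φ⟩` for
`φ ∈ K` (the variational principle `minEnergyOn_le_rayleigh_of_mem` after normalising; trivial for
`φ = 0`). [cite: Tasaki2020, §2.2] -/
theorem minEnergyOn_mul_re_star_dotProduct_self_le {H : Matrix n n ℂ} (hH : H.IsHermitian)
    (K : Submodule ℂ (n → ℂ)) {φ : n → ℂ} (hφ : φ ∈ K) :
    H.minEnergyOn K * (star φ ⬝ᵥ φ).re ≤ (star φ ⬝ᵥ (H *ᵥ φ)).re := by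
  by_cases h0 : φ = 0
  · subst h0
    simp
  have hpos : 0 < (star φ ⬝ᵥ φ).re := RayleighBottom.re_star_dotProduct_self_pos h0
  obtain ⟨c, hc1, hc2⟩ := RayleighBottom.exists_smul_unit hpos
  have hle := minEnergyOn_le_rayleigh_of_mem hH K (K.smul_mem c hφ) hc1
  rw [RayleighBottom.star_smul_dotProduct_mulVec_smul, RayleighBottom.re_star_mul_self_mul] at hle
  calc H.minEnergyOn K * (star φ ⬝ᵥ φ).re
      ≤ ‖c‖ ^ 2 * (star φ ⬝ᵥ (H *ᵥ φ)).re * (star φ ⬝ᵥ φ).re :=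
        mul_le_mul_of_nonneg_right hle hpos.le
    _ = (star φ ⬝ᵥ (H *ᵥ φ)).re * (‖c‖ ^ 2 * (star φ ⬝ᵥ φ).re) := by ring
    _ = (star φ ⬝ᵥ (H *ᵥ φ)).re := by rw [hc2, mul_one]

omit [DecidableEq n] in
/-- Polarisation, even part: `Re⟨ψ + aη, M(ψ + aη)⟩ + Re⟨ψ − aη, M(ψ − aη)⟩ = 2 Re⟨ψ, Mψ⟩ + 2a² Re⟨η, Mη⟩`
(`a` real). [folklore] -/
private theorem re_quadForm_add_add_re_quadForm_sub (M : Matrix n n ℂ) (ψ η : n → ℂ) (a : ℝ) :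
    (star (ψ + (a : ℂ) • η) ⬝ᵥ (M *ᵥ (ψ + (a : ℂ) • η))).re +
        (star (ψ - (a : ℂ) • η) ⬝ᵥ (M *ᵥ (ψ - (a : ℂ) • η))).re =
      2 * (star ψ ⬝ᵥ (M *ᵥ ψ)).re + 2 * a ^ 2 * (star η ⬝ᵥ (M *ᵥ η)).re := by
  have e1 : ψ + (a : ℂ) • η = (1 : ℂ) • ψ + (a : ℂ) • η := by rw [one_smul]
  have e2 : ψ - (a : ℂ) • η = (1 : ℂ) • ψ + (-(a : ℂ)) • η := by
    rw [one_smul, neg_smul, sub_eq_add_neg]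
  rw [e1, e2, RayleighBottom.star_lincomb_dotProduct_mulVec,
    RayleighBottom.star_lincomb_dotProduct_mulVec]
  simp only [star_one, one_mul, mul_one, star_neg, Complex.star_def, Complex.conj_ofReal,
    Complex.add_re, Complex.mul_re, Complex.mul_im, Complex.neg_re, Complex.neg_im, Complex.ofReal_re,
    Complex.ofReal_im, zero_mul, sub_zero, mul_zero, add_zero]
  ring

omit [DecidableEq n] in
/-- Polarisation, odd part, for a Hermitian `M`: `Re⟨ψ + aη, M(ψ + aη)⟩ − Re⟨ψ − aη, M(ψ − aη)⟩ =
4a Re⟨ψ, Mη⟩` (`a` real; `⟨η, Mψ⟩ = conj ⟨ψ, Mη⟩`). [folklore] -/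
private theorem re_quadForm_add_sub_re_quadForm_sub {M : Matrix n n ℂ} (hM : M.IsHermitian)
    (ψ η : n → ℂ) (a : ℝ) :
    (star (ψ + (a : ℂ) • η) ⬝ᵥ (M *ᵥ (ψ + (a : ℂ) • η))).re -
        (star (ψ - (a : ℂ) • η) ⬝ᵥ (M *ᵥ (ψ - (a : ℂ) • η))).re =
      4 * a * (star ψ ⬝ᵥ (M *ᵥ η)).re := by
  have hsym : star η ⬝ᵥ (M *ᵥ ψ) = (starRingEnd ℂ) (star ψ ⬝ᵥ (M *ᵥ η)) := by
    rw [star_dotProduct, star_mulVec, hM.eq, ← dotProduct_mulVec, Complex.star_def]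
  have e1 : ψ + (a : ℂ) • η = (1 : ℂ) • ψ + (a : ℂ) • η := by rw [one_smul]
  have e2 : ψ - (a : ℂ) • η = (1 : ℂ) • ψ + (-(a : ℂ)) • η := by
    rw [one_smul, neg_smul, sub_eq_add_neg]
  rw [e1, e2, RayleighBottom.star_lincomb_dotProduct_mulVec,
    RayleighBottom.star_lincomb_dotProduct_mulVec, hsym]
  simp only [star_one, one_mul, mul_one, star_neg, Complex.star_def, Complex.conj_ofReal,
    Complex.add_re, Complex.mul_re, Complex.mul_im, Complex.neg_re, Complex.neg_im, Complex.ofReal_re,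
    Complex.ofReal_im, zero_mul, sub_zero, mul_zero, add_zero, Complex.conj_re,
    Complex.conj_im]
  ring

/-- The norms of `ψ ± aη`: `‖ψ + aη‖² + ‖ψ − aη‖² = 2‖ψ‖² + 2a²‖η‖²` (`a` real). [folklore] -/
private theorem re_star_dotProduct_self_add_sub (ψ η : n → ℂ) (a : ℝ) :
    (star (ψ + (a : ℂ) • η) ⬝ᵥ (ψ + (a : ℂ) • η)).re +
        (star (ψ - (a : ℂ) • η) ⬝ᵥ (ψ - (a : ℂ) • η)).re =
      2 * (star ψ ⬝ᵥ ψ).re + 2 * a ^ 2 * (star η ⬝ᵥ η).re := by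
  have h := re_quadForm_add_add_re_quadForm_sub (1 : Matrix n n ℂ) ψ η a
  simpa only [Matrix.one_mulVec] using h

end Generic

/-! ### The second-order Rayleigh expansion in the flux -/

/-- The flux envelope is the sector energy of the uniformly twisted torus `uniformTwistTT'`
(gauge invariance, `fluxEnergyTT'_eq_minEnergyOn_uniform`). [cite: Watanabe2019, §2.2.3 and §4.1] -/
theorem fluxEnergyTT'_eq_minEnergyOn_uniformTwistTT' (hL : 3 ≤ L) (t' U δ θ : ℝ) :
    fluxEnergyTT' L t' U δ θ =
      (uniformTwistTT' L t' U θ).minEnergyOn (szSector (2 * ⌊(1 - δ) * (L : ℝ) ^ 2 / 2⌋₊) 0) := by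
  rw [fluxEnergyTT'_eq_minEnergyOn_uniform hL]
  rfl

/-- **Pricing the flux at `±θ` with the trial vectors `ψ ± a η`** (`L ≥ 3`; `ψ, η` in the sector
`(N_L, 0)`, `a` real): the sum of the two variational inequalities, in which the bond currents
survive only through the cross term `4a sin(θ/L) Re⟨ψ, 𝒥 η⟩`:
`E(θ)(2‖ψ‖² + 2a²‖η‖²) ≤ 2Re⟨ψ,Hψ⟩ + 2a²Re⟨η,Hη⟩ + (1 − cos(θ/L))(2Re⟨ψ,𝒦ψ⟩ + 2a²Re⟨η,𝒦η⟩)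
+ 4a sin(θ/L) Re⟨ψ,𝒥η⟩`. [cite: ScalapinoWhiteZhang1993, §II] -/
theorem fluxEnergyTT'_mul_le_rayleigh_pair (hL : 3 ≤ L) (t' U δ θ : ℝ)
    {ψ η : Fock (Orb (FermionTorus 2 L))}
    (hψ : ψ ∈ szSector (2 * ⌊(1 - δ) * (L : ℝ) ^ 2 / 2⌋₊) 0)
    (hη : η ∈ szSector (2 * ⌊(1 - δ) * (L : ℝ) ^ 2 / 2⌋₊) 0) (a : ℝ) :
    fluxEnergyTT' L t' U δ θ * (2 * (star ψ ⬝ᵥ ψ).re + 2 * a ^ 2 * (star η ⬝ᵥ η).re) ≤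
      (2 * (star ψ ⬝ᵥ (hubbardTorusTT' L 1 t' U *ᵥ ψ)).re +
          2 * a ^ 2 * (star η ⬝ᵥ (hubbardTorusTT' L 1 t' U *ᵥ η)).re) +
        (1 - Real.cos (θ / L)) *
          (2 * (star ψ ⬝ᵥ (kinOpTT' L t' *ᵥ ψ)).re + 2 * a ^ 2 * (star η ⬝ᵥ (kinOpTT' L t' *ᵥ η)).re) +
        4 * a * Real.sin (θ / L) * (star ψ ⬝ᵥ (curOpTT' L t' *ᵥ η)).re := by
  have hp_mem : ψ + (a : ℂ) • η ∈ szSector (2 * ⌊(1 - δ) * (L : ℝ) ^ 2 / 2⌋₊) 0 :=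
    Submodule.add_mem _ hψ (Submodule.smul_mem _ _ hη)
  have hm_mem : ψ - (a : ℂ) • η ∈ szSector (2 * ⌊(1 - δ) * (L : ℝ) ^ 2 / 2⌋₊) 0 :=
    Submodule.sub_mem _ hψ (Submodule.smul_mem _ _ hη)
  have hp := minEnergyOn_mul_re_star_dotProduct_self_le (isHermitian_uniformTwistTT' t' U θ)
    (szSector (2 * ⌊(1 - δ) * (L : ℝ) ^ 2 / 2⌋₊) 0) hp_mem
  have hm := minEnergyOn_mul_re_star_dotProduct_self_le (isHermitian_uniformTwistTT' t' U (-θ))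
    (szSector (2 * ⌊(1 - δ) * (L : ℝ) ^ 2 / 2⌋₊) 0) hm_mem
  rw [← fluxEnergyTT'_eq_minEnergyOn_uniformTwistTT' hL] at hp hm
  rw [fluxEnergyTT'_neg] at hm
  rw [re_star_dotProduct_uniformTwistTT'_mulVec_eq_kin_cur hL] at hp hm
  rw [neg_div, Real.cos_neg, Real.sin_neg] at hm
  have eN := re_star_dotProduct_self_add_sub ψ η a
  have eH := re_quadForm_add_add_re_quadForm_sub (hubbardTorusTT' L 1 t' U) ψ η a
  have eK := re_quadForm_add_add_re_quadForm_sub (kinOpTT' L t') ψ η a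
  have eJ := re_quadForm_add_sub_re_quadForm_sub (isHermitian_curOpTT' (L := L) t') ψ η a
  set E := fluxEnergyTT' L t' U δ θ
  set c := 1 - Real.cos (θ / L)
  set s := Real.sin (θ / L)
  set Np := (star (ψ + (a : ℂ) • η) ⬝ᵥ (ψ + (a : ℂ) • η)).re
  set Nm := (star (ψ - (a : ℂ) • η) ⬝ᵥ (ψ - (a : ℂ) • η)).re
  set Kp := (star (ψ + (a : ℂ) • η) ⬝ᵥ (kinOpTT' L t' *ᵥ (ψ + (a : ℂ) • η))).re
  set Km := (star (ψ - (a : ℂ) • η) ⬝ᵥ (kinOpTT' L t' *ᵥ (ψ - (a : ℂ) • η))).re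
  set Jp := (star (ψ + (a : ℂ) • η) ⬝ᵥ (curOpTT' L t' *ᵥ (ψ + (a : ℂ) • η))).re
  set Jm := (star (ψ - (a : ℂ) • η) ⬝ᵥ (curOpTT' L t' *ᵥ (ψ - (a : ℂ) • η))).re
  have eN' : E * Np + E * Nm = E * (2 * (star ψ ⬝ᵥ ψ).re + 2 * a ^ 2 * (star η ⬝ᵥ η).re) := by
    rw [← eN]; ring
  have eK' : c * Kp + c * Km =
      c * (2 * (star ψ ⬝ᵥ (kinOpTT' L t' *ᵥ ψ)).re + 2 * a ^ 2 * (star η ⬝ᵥ (kinOpTT' L t' *ᵥ η)).re) := by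
    rw [← eK]; ring
  have eJ' : s * Jp - s * Jm = s * (4 * a * (star ψ ⬝ᵥ (curOpTT' L t' *ᵥ η)).re) := by
    rw [← eJ]; ring
  linarith [hp, hm, eN', eH, eK', eJ']

/-! ### The second-order (Kohn) ceiling -/

/-- Real-variable core of the `u → 0⁺` expansion: from the stiffness hypothesis at flux `Lu` and the
`±θ` pair inequality with `a = λu`, the bound `ρ L² ≤ K/2 + 2λB + λ²(H_η − E₀ n_η) + C u²` with an
explicit constant `C` (`|1 − cos u − u²/2| ≤ 5u⁴/96`, `u − u³/4 < sin u ≤ u` on `0 < u ≤ 1`). [folklore] -/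
private theorem stiffness_real_core {ρs L u lam E0 Eθ Kψ Kη B Hη nη : ℝ} (hnη : 0 ≤ nη)
    (hu0 : 0 < u) (hu1 : u ≤ 1)
    (hst : ρs * (L * u) ^ 2 ≤ Eθ - E0)
    (pair : Eθ * (2 * 1 + 2 * (lam * u) ^ 2 * nη) ≤
      (2 * E0 + 2 * (lam * u) ^ 2 * Hη) +
        (1 - Real.cos u) * (2 * Kψ + 2 * (lam * u) ^ 2 * Kη) +
        4 * (lam * u) * Real.sin u * B) :
    ρs * L ^ 2 ≤ Kψ / 2 + 2 * lam * B + lam ^ 2 * (Hη - E0 * nη) +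
      ((lam ^ 2 * |Kη| + 5 / 48 * (|Kψ| + lam ^ 2 * |Kη|) + |lam * B| +
        2 * |ρs * L ^ 2| * lam ^ 2 * nη) / 2 + 1) * u ^ 2 := by
  have hS : 0 ≤ 2 * (1 : ℝ) + 2 * (lam * u) ^ 2 * nη := by positivity
  have h2 := (mul_le_mul_of_nonneg_right (show E0 + ρs * (L * u) ^ 2 ≤ Eθ by linarith) hS).trans pair
  -- trigonometric error terms
  have hc1 : 1 - Real.cos u ≤ u ^ 2 / 2 := by
    linarith [Real.one_sub_sq_div_two_le_cos (x := u)]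
  have hcb := Real.cos_bound (show |u| ≤ 1 by rwa [abs_of_pos hu0])
  rw [abs_of_pos hu0] at hcb
  have hc2 : u ^ 2 / 2 - 5 / 96 * u ^ 4 ≤ 1 - Real.cos u := by
    linarith [(abs_le.1 hcb).2]
  have hs1 : Real.sin u ≤ u := Real.sin_le hu0.le
  have hs2 := Real.sin_gt_sub_cube hu0
  have hec : |1 - Real.cos u - u ^ 2 / 2| ≤ 5 / 96 * u ^ 4 := abs_le.2 ⟨by linarith, by linarith⟩
  have hu2 : u ^ 2 ≤ 1 := by nlinarith
  have hu4 : 0 ≤ u ^ 4 := by positivity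
  have hes : |u * Real.sin u - u ^ 2| ≤ u ^ 4 / 4 := by
    refine abs_le.2 ⟨?_, ?_⟩
    · have h' : u * (u - u ^ 3 / 6) ≤ u * Real.sin u := mul_le_mul_of_nonneg_left hs2.le hu0.le
      nlinarith
    · have h' : u * Real.sin u ≤ u * u := mul_le_mul_of_nonneg_left hs1 hu0.le
      nlinarith
  -- product bounds
  have hX : |2 * Kψ + 2 * (lam * u) ^ 2 * Kη| ≤ 2 * |Kψ| + 2 * lam ^ 2 * |Kη| := by
    have h1' : |2 * Kψ + 2 * (lam * u) ^ 2 * Kη| ≤ |2 * Kψ| + |2 * (lam * u) ^ 2 * Kη| :=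
      abs_add_le _ _
    have h2' : |2 * Kψ| = 2 * |Kψ| := by
      rw [abs_mul, abs_of_pos (by norm_num : (0 : ℝ) < 2)]
    have h3' : |2 * (lam * u) ^ 2 * Kη| = 2 * (lam * u) ^ 2 * |Kη| := by
      rw [abs_mul, abs_mul, abs_of_pos (by norm_num : (0 : ℝ) < 2), abs_of_nonneg (sq_nonneg _)]
    have h4' : (lam * u) ^ 2 * |Kη| ≤ lam ^ 2 * |Kη| := by
      have hw : 0 ≤ lam ^ 2 * |Kη| * (1 - u ^ 2) :=
        mul_nonneg (mul_nonneg (sq_nonneg _) (abs_nonneg _)) (sub_nonneg.2 hu2)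
      nlinarith
    linarith
  have P1 : (1 - Real.cos u - u ^ 2 / 2) * (2 * Kψ + 2 * (lam * u) ^ 2 * Kη) ≤
      5 / 96 * u ^ 4 * (2 * |Kψ| + 2 * lam ^ 2 * |Kη|) := by
    calc (1 - Real.cos u - u ^ 2 / 2) * (2 * Kψ + 2 * (lam * u) ^ 2 * Kη)
        ≤ |(1 - Real.cos u - u ^ 2 / 2) * (2 * Kψ + 2 * (lam * u) ^ 2 * Kη)| := le_abs_self _
      _ = |1 - Real.cos u - u ^ 2 / 2| * |2 * Kψ + 2 * (lam * u) ^ 2 * Kη| := abs_mul _ _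
      _ ≤ 5 / 96 * u ^ 4 * (2 * |Kψ| + 2 * lam ^ 2 * |Kη|) :=
          mul_le_mul hec hX (abs_nonneg _) (by positivity)
  have P2 : (u * Real.sin u - u ^ 2) * (4 * lam * B) ≤ u ^ 4 / 4 * (4 * |lam * B|) := by
    calc (u * Real.sin u - u ^ 2) * (4 * lam * B)
        ≤ |(u * Real.sin u - u ^ 2) * (4 * lam * B)| := le_abs_self _
      _ = |u * Real.sin u - u ^ 2| * (4 * |lam * B|) := by
          rw [abs_mul, show 4 * lam * B = 4 * (lam * B) by ring, abs_mul,
            abs_of_pos (by norm_num : (0 : ℝ) < 4)]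
      _ ≤ u ^ 4 / 4 * (4 * |lam * B|) :=
          mul_le_mul_of_nonneg_right hes (by positivity)
  have P3 : lam ^ 2 * u ^ 4 * Kη ≤ lam ^ 2 * u ^ 4 * |Kη| :=
    mul_le_mul_of_nonneg_left (le_abs_self _) (by positivity)
  have P4 : -(2 * (ρs * L ^ 2) * lam ^ 2 * u ^ 4 * nη) ≤
      2 * |ρs * L ^ 2| * lam ^ 2 * u ^ 4 * nη := by
    have h := neg_abs_le (ρs * L ^ 2)
    have hw : 0 ≤ lam ^ 2 * u ^ 4 * nη := by positivity
    nlinarith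
  have hu2pos : 0 < 2 * u ^ 2 := by positivity
  have main : 2 * u ^ 2 * (ρs * L ^ 2) ≤
      2 * u ^ 2 * (Kψ / 2 + 2 * lam * B + lam ^ 2 * (Hη - E0 * nη) +
        ((lam ^ 2 * |Kη| + 5 / 48 * (|Kψ| + lam ^ 2 * |Kη|) + |lam * B| +
          2 * |ρs * L ^ 2| * lam ^ 2 * nη) / 2 + 1) * u ^ 2) := by
    nlinarith [h2, P1, P2, P3, P4, hu4]
  exact le_of_mul_le_mul_left main hu2pos

/-- Real-variable assembly of the second-order ceiling: if for every small `u > 0` the stiffness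
hypothesis at flux `Lu` and the `±` pair inequality with `a = λu` hold for some sector energy `E_θ`,
then `ρ L² ≤ K/2 + 2λB + λ²(H_η − E₀ n_η)` (`stiffness_real_core` and `u → 0⁺`). [folklore] -/
private theorem stiffness_real_limit {ρs L lam E0 Kψ Kη B Hη nη θ₀ : ℝ} (hnη : 0 ≤ nη)
    (hθ₀ : 0 < θ₀) (hL : 0 < L)
    (h : ∀ u : ℝ, 0 < u → u ≤ 1 → L * u ≤ θ₀ → ∃ Eθ : ℝ,
      ρs * (L * u) ^ 2 ≤ Eθ - E0 ∧
        Eθ * (2 * 1 + 2 * (lam * u) ^ 2 * nη) ≤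
          (2 * E0 + 2 * (lam * u) ^ 2 * Hη) +
            (1 - Real.cos u) * (2 * Kψ + 2 * (lam * u) ^ 2 * Kη) +
            4 * (lam * u) * Real.sin u * B) :
    ρs * L ^ 2 ≤ Kψ / 2 + 2 * lam * B + lam ^ 2 * (Hη - E0 * nη) := by
  set C := (lam ^ 2 * |Kη| + 5 / 48 * (|Kψ| + lam ^ 2 * |Kη|) + |lam * B| +
      2 * |ρs * L ^ 2| * lam ^ 2 * nη) / 2 + 1 with hC
  have hC0 : 0 < C := by
    have h' : 0 ≤ 2 * |ρs * L ^ 2| * lam ^ 2 * nη := mul_nonneg (by positivity) hnη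
    have h'' : 0 ≤ lam ^ 2 * |Kη| + 5 / 48 * (|Kψ| + lam ^ 2 * |Kη|) + |lam * B| := by positivity
    rw [hC]
    linarith
  refine le_of_forall_pos_le_add fun ε hε => ?_
  set u := min (min 1 (θ₀ / L)) (ε / C) with hu
  have hu0 : 0 < u := lt_min (lt_min one_pos (div_pos hθ₀ hL)) (div_pos hε hC0)
  have hu1 : u ≤ 1 := (min_le_left _ _).trans (min_le_left _ _)
  have huθ : L * u ≤ θ₀ := by
    have h' : u ≤ θ₀ / L := (min_le_left _ _).trans (min_le_right _ _)
    rw [le_div_iff₀ hL] at h'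
    linarith
  have huε : u ≤ ε / C := min_le_right _ _
  have hCu : C * u ^ 2 ≤ ε := by
    have h3 : C * u ≤ ε := by
      rw [le_div_iff₀ hC0] at huε
      linarith
    nlinarith
  obtain ⟨Eθ, hst, pair⟩ := h u hu0 hu1 huθ
  have key := stiffness_real_core hnη hu0 hu1 hst pair
  rw [← hC] at key
  linarith

/-- **Second-order Rayleigh (Kohn) inequality for a flux stiffness, `t–t'` torus** (`L ≥ 3`): if
`E^{tt'}_L(θ) − E^{tt'}_L(0) ≥ ρ θ²` for `|θ| ≤ θ₀` (`θ₀ > 0`), then for every zero-flux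
`(N_L, 0)`-sector ground state `ψ` (unit vector), every vector `η` of the same sector and every real
`λ`: `ρ L² ≤ ½ Re⟨ψ, 𝒦 ψ⟩ + 2λ Re⟨ψ, 𝒥 η⟩ + λ² (Re⟨η, H η⟩ − E₀ ‖η‖²)`, `𝒦 = kinOpTT'`,
`𝒥 = curOpTT'`, `E₀ = E^{tt'}_L(0)`. Proof: `fluxEnergyTT'_mul_le_rayleigh_pair` with `a = λθ/L`,
the stiffness hypothesis at `θ = Lu`, and `u → 0⁺`. Optimising over `λ, η` this is Kohn's
second-order formula for the flux curvature, `D ∝ ⟨−T_x⟩ − 2 Σ_{n≠0} |⟨n|J_x|0⟩|²/(E_n − E₀)`, as a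
one-sided inequality valid for degenerate ground spaces as well. [cite: ScalapinoWhiteZhang1993, §II] -/
theorem stiffnessTT'_mul_sq_le_of_isGroundStateInSector (hL : 3 ≤ L) (t' U δ : ℝ)
    {ρs θ₀ : ℝ} (hθ₀ : 0 < θ₀)
    (hstiff : ∀ θ : ℝ, |θ| ≤ θ₀ →
      ρs * θ ^ 2 ≤ fluxEnergyTT' L t' U δ θ - fluxEnergyTT' L t' U δ 0)
    {ψ : Fock (Orb (FermionTorus 2 L))}
    (hgs : IsGroundStateInSector (hubbardTorusTT' L 1 t' U) (2 * ⌊(1 - δ) * (L : ℝ) ^ 2 / 2⌋₊) 0 ψ)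
    (h1 : star ψ ⬝ᵥ ψ = 1) {η : Fock (Orb (FermionTorus 2 L))}
    (hη : η ∈ szSector (2 * ⌊(1 - δ) * (L : ℝ) ^ 2 / 2⌋₊) 0) (lam : ℝ) :
    ρs * (L : ℝ) ^ 2 ≤
      (star ψ ⬝ᵥ (kinOpTT' L t' *ᵥ ψ)).re / 2 +
        2 * lam * (star ψ ⬝ᵥ (curOpTT' L t' *ᵥ η)).re +
        lam ^ 2 * ((star η ⬝ᵥ (hubbardTorusTT' L 1 t' U *ᵥ η)).re -
          fluxEnergyTT' L t' U δ 0 * (star η ⬝ᵥ η).re) := by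
  have hHψ : (star ψ ⬝ᵥ (hubbardTorusTT' L 1 t' U *ᵥ ψ)).re = fluxEnergyTT' L t' U δ 0 :=
    re_star_dotProduct_mulVec_eq_fluxEnergyTT'_zero t' U δ hgs h1
  have h1re : (star ψ ⬝ᵥ ψ).re = 1 := by rw [h1, Complex.one_re]
  have hnη : 0 ≤ (star η ⬝ᵥ η).re := by
    rw [RayleighBottom.re_star_dotProduct_self]
    exact Finset.sum_nonneg fun i _ => sq_nonneg _
  have hL0 : (0 : ℝ) < L := Nat.cast_pos.2 (NeZero.pos L)
  refine stiffness_real_limit (Kη := (star η ⬝ᵥ (kinOpTT' L t' *ᵥ η)).re) hnη hθ₀ hL0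
    fun u hu0 hu1 huθ => ?_
  have pair := fluxEnergyTT'_mul_le_rayleigh_pair hL t' U δ ((L : ℝ) * u) hgs.1 hη (lam * u)
  have hdiv : (L : ℝ) * u / L = u := by field_simp
  rw [hdiv, h1re, hHψ] at pair
  have hst := hstiff ((L : ℝ) * u) (by rw [abs_of_pos (by positivity)]; exact huθ)
  exact ⟨fluxEnergyTT' L t' U δ ((L : ℝ) * u), hst, pair⟩

/-- `⟨ψ, 𝒥 (𝒥 ψ)⟩ = ‖𝒥ψ‖²` (`𝒥` Hermitian): the zeroth moment `M₀` of the current strength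
function. [cite: Lipparini2008, eq. (8.30)] -/
theorem star_dotProduct_curOpTT'_curOpTT'_mulVec (t' : ℝ) (ψ : Fock (Orb (FermionTorus 2 L))) :
    star ψ ⬝ᵥ (curOpTT' L t' *ᵥ (curOpTT' L t' *ᵥ ψ)) =
      star (curOpTT' L t' *ᵥ ψ) ⬝ᵥ (curOpTT' L t' *ᵥ ψ) := by
  rw [star_mulVec, (isHermitian_curOpTT' (L := L) t').eq, ← dotProduct_mulVec]

/-- **Certified-row form of the second-order ceiling** (`L ≥ 3`): if
`E^{tt'}_L(θ) − E^{tt'}_L(0) ≥ ρ θ²` for `|θ| ≤ θ₀` and a zero-flux `(N_L, 0)`-sector ground state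
`ψ` (unit vector) has certified bounds `½Re⟨ψ, 𝒦 ψ⟩ ≤ K_hi`, `‖𝒥ψ‖² ≥ M0_lo ≥ 0` and
`Re⟨𝒥ψ, H 𝒥ψ⟩ − E₀‖𝒥ψ‖² ≤ M1_hi` with `M1_hi > 0`, then `ρ L² ≤ K_hi − M0_lo²/M1_hi`
(`η = 𝒥ψ`, `λ = −M0_lo/M1_hi` in `stiffnessTT'_mul_sq_le_of_isGroundStateInSector`; this is the
sum-rule inequality `m₋₁ ≥ m₀²/m₁` of Bohigas–Lane–Martorell applied to Kohn's second-order term).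
[cite: Lipparini2008, eq. (10.64)] -/
theorem stiffnessTT'_mul_sq_le_of_certified_moments (hL : 3 ≤ L) (t' U δ : ℝ)
    {ρs θ₀ : ℝ} (hθ₀ : 0 < θ₀)
    (hstiff : ∀ θ : ℝ, |θ| ≤ θ₀ →
      ρs * θ ^ 2 ≤ fluxEnergyTT' L t' U δ θ - fluxEnergyTT' L t' U δ 0)
    {ψ : Fock (Orb (FermionTorus 2 L))}
    (hgs : IsGroundStateInSector (hubbardTorusTT' L 1 t' U) (2 * ⌊(1 - δ) * (L : ℝ) ^ 2 / 2⌋₊) 0 ψ)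
    (h1 : star ψ ⬝ᵥ ψ = 1) {Khi M0lo M1hi : ℝ}
    (hK : (star ψ ⬝ᵥ (kinOpTT' L t' *ᵥ ψ)).re / 2 ≤ Khi)
    (hM0 : M0lo ≤ (star (curOpTT' L t' *ᵥ ψ) ⬝ᵥ (curOpTT' L t' *ᵥ ψ)).re) (hM0nn : 0 ≤ M0lo)
    (hM1 : (star (curOpTT' L t' *ᵥ ψ) ⬝ᵥ (hubbardTorusTT' L 1 t' U *ᵥ (curOpTT' L t' *ᵥ ψ))).re -
        fluxEnergyTT' L t' U δ 0 * (star (curOpTT' L t' *ᵥ ψ) ⬝ᵥ (curOpTT' L t' *ᵥ ψ)).re ≤ M1hi)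
    (hM1pos : 0 < M1hi) :
    ρs * (L : ℝ) ^ 2 ≤ Khi - M0lo ^ 2 / M1hi := by
  have h := stiffnessTT'_mul_sq_le_of_isGroundStateInSector hL t' U δ hθ₀ hstiff hgs h1
    (curOpTT'_mulVec_mem_szSector t' hgs.1) (-M0lo / M1hi)
  rw [star_dotProduct_curOpTT'_curOpTT'_mulVec] at h
  have hlam : 2 * (-M0lo / M1hi) ≤ 0 := by
    have : 0 ≤ M0lo / M1hi := div_nonneg hM0nn hM1pos.le
    rw [neg_div]; linarith
  have hA := mul_le_mul_of_nonpos_left hM0 hlam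
  have hB' := mul_le_mul_of_nonneg_left hM1 (sq_nonneg (-M0lo / M1hi))
  have e : 2 * (-M0lo / M1hi) * M0lo + (-M0lo / M1hi) ^ 2 * M1hi = -(M0lo ^ 2 / M1hi) := by
    field_simp
    ring
  linarith

/-! ### The first moment as a double commutator (the SDP objective `D₁ = ½[𝒥,[H,𝒥]]`) -/

/-- **`m₁` as a double commutator** (Lipparini 2008 eq. (8.30), `m₁ = ½⟨0|[F,[H,F]]|0⟩`): for
Hermitian `H`, `J` and an eigenvector `Hψ = Eψ`,
`⟨ψ, (J[H,J] − [H,J]J) ψ⟩ = 2⟨Jψ, H Jψ⟩ − 2E ‖Jψ‖²`, i.e. `Re⟨Jψ,(H − E)Jψ⟩ = ½⟨ψ,[J,[H,J]]ψ⟩` —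
the first moment of the strength function of `J` is the expectation of a fixed operator polynomial
(degree ≤ 4 for `J = curOpTT'`, `H` the Hubbard torus), hence an SDP objective. [cite: Lipparini2008, eq. (8.30)] -/
theorem star_dotProduct_doubleCommutator_mulVec {n : Type*} [Fintype n] [DecidableEq n]
    {H J : Matrix n n ℂ} (hH : H.IsHermitian) (hJ : J.IsHermitian) {ψ : n → ℂ} {E : ℝ}
    (hψ : H *ᵥ ψ = (E : ℂ) • ψ) :
    star ψ ⬝ᵥ ((J * (H * J - J * H) - (H * J - J * H) * J) *ᵥ ψ) =
      2 * (star (J *ᵥ ψ) ⬝ᵥ (H *ᵥ (J *ᵥ ψ))) - 2 * (E : ℂ) * (star (J *ᵥ ψ) ⬝ᵥ (J *ᵥ ψ)) := by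
  have hJv : ∀ v : n → ℂ, star ψ ⬝ᵥ (J *ᵥ v) = star (J *ᵥ ψ) ⬝ᵥ v := fun v => by
    rw [star_mulVec, hJ.eq, ← dotProduct_mulVec]
  have hHv : ∀ v : n → ℂ, star ψ ⬝ᵥ (H *ᵥ v) = (E : ℂ) * (star ψ ⬝ᵥ v) := fun v => by
    calc star ψ ⬝ᵥ (H *ᵥ v) = star (H *ᵥ ψ) ⬝ᵥ v := by
          rw [star_mulVec, hH.eq, ← dotProduct_mulVec]
      _ = (E : ℂ) * (star ψ ⬝ᵥ v) := by
          rw [hψ, star_smul, smul_dotProduct, Complex.star_def, Complex.conj_ofReal, smul_eq_mul]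
  simp only [sub_mulVec, ← mulVec_mulVec, mulVec_sub, hψ, mulVec_smul, dotProduct_sub,
    dotProduct_smul, smul_eq_mul]
  simp only [hJv, hHv]
  ring

/-- The `t–t'` torus instance: for a zero-flux `(N, M)`-sector ground state `ψ`,
`Re⟨𝒥ψ, H 𝒥ψ⟩ − E₀ ‖𝒥ψ‖² = ½ Re⟨ψ, (𝒥[H,𝒥] − [H,𝒥]𝒥) ψ⟩` with `𝒥 = curOpTT'`, `H = hubbardTorusTT' L 1 t' U`,
`E₀` the sector energy — the hypothesis `hM1` of `stiffnessTT'_mul_sq_le_of_certified_moments` is a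
bound on the expectation of ONE Hermitian fermion polynomial. [cite: Lipparini2008, eq. (8.30)] -/
theorem curOpTT'_firstMoment_eq_re_doubleCommutator (t' U : ℝ) {N : ℕ} {M : ℝ}
    {ψ : Fock (Orb (FermionTorus 2 L))} (hgs : IsGroundStateInSector (hubbardTorusTT' L 1 t' U) N M ψ) :
    (star (curOpTT' L t' *ᵥ ψ) ⬝ᵥ (hubbardTorusTT' L 1 t' U *ᵥ (curOpTT' L t' *ᵥ ψ))).re -
        (hubbardTorusTT' L 1 t' U).minEnergyOn (szSector N M) *
          (star (curOpTT' L t' *ᵥ ψ) ⬝ᵥ (curOpTT' L t' *ᵥ ψ)).re =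
      (star ψ ⬝ᵥ ((curOpTT' L t' * (hubbardTorusTT' L 1 t' U * curOpTT' L t' -
          curOpTT' L t' * hubbardTorusTT' L 1 t' U) -
        (hubbardTorusTT' L 1 t' U * curOpTT' L t' - curOpTT' L t' * hubbardTorusTT' L 1 t' U) *
          curOpTT' L t') *ᵥ ψ)).re / 2 := by
  obtain ⟨-, -, hH⟩ := hgs
  rw [star_dotProduct_doubleCommutator_mulVec (hubbardTorusTT'_isHermitian L 1 t' U)
    (isHermitian_curOpTT' (L := L) t') hH]
  have hreal : (star (curOpTT' L t' *ᵥ ψ) ⬝ᵥ (curOpTT' L t' *ᵥ ψ)).im = 0 := by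
    rw [RayleighBottom.star_dotProduct_self_eq_sum, Complex.ofReal_im]
  simp only [Complex.sub_re, Complex.mul_re, Complex.re_ofNat, Complex.im_ofNat, Complex.ofReal_re,
    Complex.ofReal_im, hreal, zero_mul, sub_zero, mul_zero]
  ring

end Literature.MathematicalPhysics.QuantumLattice
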